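import Mathlib
import Summits.KontsevichZagierPeriods.KontsevichZagierPeriods.Theorems.SoloInformedLegendreKernel
import HarnessLib
import HarnessLib.Audit

/-!
# Division by translation I: the algebra of Jacobi's addition map (solo-informed, s43)

First file of LEMMA XXIX.1 KERNEL ("division of the quarter-period at real torsion points is a
chain of translation moves", §6quindecies of the residency paper).  For a Legendre parameter
`0 < m < 1` write `w(x) = √(1−x²)·√(1−m x²)` and, for an amplitude `0 ≤ a < 1` (`a = sn v`),

  `T_a(t) = (t·w(a) + a·w(t)) / (1 − m a² t²)`        (`= sn(u+v)` for `t = sn u`),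

Jacobi's ADDITION MAP — the `x`-coordinate of translation by the point `(a, w(a))` of the curve
`y² = (1−x²)(1−m x²)`.  This file is pure algebra and one-variable calculus:

* the addition theorems for `cn`, `dn` as polynomial identities
  `(1 − m a²t²)²(1 − T²) = (c_a c_t − a t d_a d_t)²`, `(1 − m a²t²)²(1 − m T²) = (d_a d_t − m a t c_a c_t)²`
  (`c_x = √(1−x²)`, `d_x = √(1−m x²)`; `soloInformed_addm_one_sub_sq`, `soloInformed_addm_one_sub_msq`);
* the SIGN LEMMA: `c_a c_t − a t d_a d_t > 0 ⟺ t²(1 − m a²) < 1 − a²` — the translated arc stays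
  inside the quarter period exactly on an ALGEBRAIC sub-slab (`soloInformed_addm_sign_iff`), because
  `(1−a²)(1−x) − a²x(1−m a²)(1−m x) = (1 − a² − x(1−m a²))·(1 − m a² x)`;
* the derivative `T_a' = (c_a c_t − a t d_a d_t)(d_a d_t − m a t c_a c_t) / ((1 − m a²t²)² c_t d_t)`
  (`soloInformed_addm_hasDerivAt`) and the JACOBIAN IDENTITY `κ(T_a(t))·|T_a'(t)| = κ(t)`,
  `κ = 1/w` (`soloInformed_addm_jacobian`): the differential of the first kind is translation
  invariant — so `t ↦ T_a(t)` is a legitimate move of rule (2) carrying `[(0,b), κ]` to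
  `[(a, T_a(b)), κ]` whenever `b²(1 − m a²) ≤ 1 − a²` (next file);
* (the SECOND-KIND companion `e(T_a)·T_a' = e − m a·(t·T_a)'`, `e = (1 − m x²)κ` — Jacobi's
  addition theorem for `Z`, differentiated — is the file `SoloInformedDivisionZeta`).

References: C. G. J. Jacobi, *Fundamenta nova* (1829), §§18, 53; E. T. Whittaker, G. N. Watson,
*A Course of Modern Analysis*, §§22.2, 22.73; H. Hancock, *Lectures on the theory of elliptic
functions* (1910), Arts. 357–371; M. Kontsevich, D. Zagier, *Periods* (2001), §1.2; this work
(solo-informed s43).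
-/

noncomputable section

open Set

namespace Summit.KontsevichZagierPeriods.KontsevichZagierPeriods.Theorems

/-! ### The addition map -/

/-- Jacobi's addition map `T_a(t) = (t·w(a) + a·w(t))/(1 − m a² t²)`, `w(x) = √(1−x²)√(1−m x²)`
(the amplitude of `u + v` for `t = sn u`, `a = sn v`). [Jacobi 1829, §18] -/
def soloInformedAddm (m a t : ℝ) : ℝ :=
  (t * (√(1 - a ^ 2) * √(1 - m * a ^ 2)) + a * (√(1 - t ^ 2) * √(1 - m * t ^ 2))) /
    (1 - m * a ^ 2 * t ^ 2)

/-- The derivative of the addition map, in closed form: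
`T_a'(t) = (c_a c_t − a t d_a d_t)(d_a d_t − m a t c_a c_t) / ((1 − m a² t²)² c_t d_t)`.
[this work] -/
def soloInformedAddmDeriv (m a t : ℝ) : ℝ :=
  (√(1 - a ^ 2) * √(1 - t ^ 2) - a * t * (√(1 - m * a ^ 2) * √(1 - m * t ^ 2))) *
      (√(1 - m * a ^ 2) * √(1 - m * t ^ 2) - m * a * t * (√(1 - a ^ 2) * √(1 - t ^ 2))) /
    ((1 - m * a ^ 2 * t ^ 2) ^ 2 * (√(1 - t ^ 2) * √(1 - m * t ^ 2)))

/-! ### Radicands and the denominator on the closed unit slab -/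

/-- For `0 ≤ x ≤ 1`, `0 < m < 1`: `0 ≤ 1 − x²` and `0 < 1 − m x²`. [folklore] -/
theorem soloInformed_addm_radicands {m x : ℝ} (hm : m ∈ Ioo (0:ℝ) 1) (hx : x ∈ Icc (0:ℝ) 1) :
    0 ≤ 1 - x ^ 2 ∧ 0 < 1 - m * x ^ 2 := by
  have hx2 : x ^ 2 ≤ 1 := by nlinarith [hx.1, hx.2]
  exact ⟨by linarith, by nlinarith [hm.1, hm.2]⟩

/-- For `0 ≤ x < 1`: `0 < 1 − x²`. [folklore] -/
theorem soloInformed_addm_radicand_pos {x : ℝ} (hx : x ∈ Ico (0:ℝ) 1) : 0 < 1 - x ^ 2 := by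
  nlinarith [hx.1, hx.2]

/-- The denominator `1 − m a² t² > 0` for `a, t ∈ [0,1]`, `0 < m < 1`. [folklore] -/
theorem soloInformed_addm_denom_pos {m a t : ℝ} (hm : m ∈ Ioo (0:ℝ) 1) (ha : a ∈ Icc (0:ℝ) 1)
    (ht : t ∈ Icc (0:ℝ) 1) : 0 < 1 - m * a ^ 2 * t ^ 2 := by
  have ha2 : a ^ 2 ≤ 1 := by nlinarith [ha.1, ha.2]
  have ht2 : t ^ 2 ≤ 1 := by nlinarith [ht.1, ht.2]
  have : a ^ 2 * t ^ 2 ≤ 1 := by nlinarith [sq_nonneg a, sq_nonneg t]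
  nlinarith [hm.1, hm.2, mul_nonneg (sq_nonneg a) (sq_nonneg t)]

/-- `T_a(0) = a`. [Jacobi 1829, §18] -/
theorem soloInformed_addm_zero (m a : ℝ) : soloInformedAddm m a 0 = a := by
  simp [soloInformedAddm]

/-- `T_0(t) = t` (translation by the origin). [Jacobi 1829, §18] -/
theorem soloInformed_addm_origin (m t : ℝ) : soloInformedAddm m 0 t = t := by
  simp [soloInformedAddm]

/-- `T_a(t) ≥ 0` for `a, t ∈ [0,1]`. [folklore] -/
theorem soloInformed_addm_nonneg {m a t : ℝ} (hm : m ∈ Ioo (0:ℝ) 1) (ha : a ∈ Icc (0:ℝ) 1)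
    (ht : t ∈ Icc (0:ℝ) 1) : 0 ≤ soloInformedAddm m a t :=
  div_nonneg (add_nonneg (mul_nonneg ht.1 (mul_nonneg (Real.sqrt_nonneg _) (Real.sqrt_nonneg _)))
    (mul_nonneg ha.1 (mul_nonneg (Real.sqrt_nonneg _) (Real.sqrt_nonneg _))))
    (soloInformed_addm_denom_pos hm ha ht).le

/-! ### The addition theorems for `cn` and `dn` as polynomial identities -/

/-- Abstract form of the `cn`-addition theorem: with `c_a² = 1−a²`, `d_a² = 1−m a²`, `c_t² = 1−t²`,
`d_t² = 1−m t²`: `(1 − m a²t²)² − (t c_a d_a + a c_t d_t)² = (c_a c_t − a t d_a d_t)²`.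
[Jacobi 1829, §18] -/
theorem soloInformed_addm_cn_identity (m a t ca da ct dt : ℝ) (hA : ca ^ 2 = 1 - a ^ 2)
    (hB : da ^ 2 = 1 - m * a ^ 2) (hC : ct ^ 2 = 1 - t ^ 2) (hE : dt ^ 2 = 1 - m * t ^ 2) :
    (1 - m * a ^ 2 * t ^ 2) ^ 2 - (t * (ca * da) + a * (ct * dt)) ^ 2 =
      (ca * ct - a * t * (da * dt)) ^ 2 := by
  linear_combination (-(t ^ 2) * da ^ 2 - ct ^ 2) * hA +
    (-(t ^ 2) * (1 - a ^ 2) - a ^ 2 * t ^ 2 * dt ^ 2) * hB +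
    (-(a ^ 2) * dt ^ 2 - (1 - a ^ 2)) * hC +
    (-(a ^ 2) * (1 - t ^ 2) - a ^ 2 * t ^ 2 * (1 - m * a ^ 2)) * hE

/-- Abstract form of the `dn`-addition theorem:
`(1 − m a²t²)² − m (t c_a d_a + a c_t d_t)² = (d_a d_t − m a t c_a c_t)²`. [Jacobi 1829, §18] -/
theorem soloInformed_addm_dn_identity (m a t ca da ct dt : ℝ) (hA : ca ^ 2 = 1 - a ^ 2)
    (hB : da ^ 2 = 1 - m * a ^ 2) (hC : ct ^ 2 = 1 - t ^ 2) (hE : dt ^ 2 = 1 - m * t ^ 2) :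
    (1 - m * a ^ 2 * t ^ 2) ^ 2 - m * (t * (ca * da) + a * (ct * dt)) ^ 2 =
      (da * dt - m * a * t * (ca * ct)) ^ 2 := by
  linear_combination (-(m * t ^ 2) * da ^ 2 - m ^ 2 * a ^ 2 * t ^ 2 * ct ^ 2) * hA +
    (-(m * t ^ 2) * (1 - a ^ 2) - dt ^ 2) * hB +
    (-(m * a ^ 2) * dt ^ 2 - m ^ 2 * a ^ 2 * t ^ 2 * (1 - a ^ 2)) * hC +
    (-(m * a ^ 2) * (1 - t ^ 2) - (1 - m * a ^ 2)) * hE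

/-- `(1 − m a²t²)²·(1 − T_a(t)²) = (c_a c_t − a t d_a d_t)²` for `a, t ∈ [0,1]`. [Jacobi 1829, §18] -/
theorem soloInformed_addm_one_sub_sq {m a t : ℝ} (hm : m ∈ Ioo (0:ℝ) 1) (ha : a ∈ Icc (0:ℝ) 1)
    (ht : t ∈ Icc (0:ℝ) 1) :
    (1 - m * a ^ 2 * t ^ 2) ^ 2 * (1 - soloInformedAddm m a t ^ 2) =
      (√(1 - a ^ 2) * √(1 - t ^ 2) - a * t * (√(1 - m * a ^ 2) * √(1 - m * t ^ 2))) ^ 2 := by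
  have hD := soloInformed_addm_denom_pos hm ha ht
  obtain ⟨hca, hda⟩ := soloInformed_addm_radicands hm ha
  obtain ⟨hct, hdt⟩ := soloInformed_addm_radicands hm ht
  rw [← soloInformed_addm_cn_identity m a t _ _ _ _ (Real.sq_sqrt hca) (Real.sq_sqrt hda.le)
    (Real.sq_sqrt hct) (Real.sq_sqrt hdt.le), soloInformedAddm, div_pow]
  field_simp

/-- `(1 − m a²t²)²·(1 − m T_a(t)²) = (d_a d_t − m a t c_a c_t)²` for `a, t ∈ [0,1]`.
[Jacobi 1829, §18] -/
theorem soloInformed_addm_one_sub_msq {m a t : ℝ} (hm : m ∈ Ioo (0:ℝ) 1) (ha : a ∈ Icc (0:ℝ) 1)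
    (ht : t ∈ Icc (0:ℝ) 1) :
    (1 - m * a ^ 2 * t ^ 2) ^ 2 * (1 - m * soloInformedAddm m a t ^ 2) =
      (√(1 - m * a ^ 2) * √(1 - m * t ^ 2) - m * a * t * (√(1 - a ^ 2) * √(1 - t ^ 2))) ^ 2 := by
  have hD := soloInformed_addm_denom_pos hm ha ht
  obtain ⟨hca, hda⟩ := soloInformed_addm_radicands hm ha
  obtain ⟨hct, hdt⟩ := soloInformed_addm_radicands hm ht
  rw [← soloInformed_addm_dn_identity m a t _ _ _ _ (Real.sq_sqrt hca) (Real.sq_sqrt hda.le)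
    (Real.sq_sqrt hct) (Real.sq_sqrt hdt.le), soloInformedAddm, div_pow]
  field_simp

/-! ### Signs: `dn(u+v) > 0` always; `cn(u+v) > 0` exactly on an algebraic sub-slab -/

/-- `d_a d_t − m a t c_a c_t > 0` for `a, t ∈ [0,1]` (`dn(u+v) ≥ √(1−m) > 0`): indeed
`(d_a d_t)² − (m a t c_a c_t)² ≥ (1−m)²`. [folklore] -/
theorem soloInformed_addm_dn_pos {m a t : ℝ} (hm : m ∈ Ioo (0:ℝ) 1) (ha : a ∈ Icc (0:ℝ) 1)
    (ht : t ∈ Icc (0:ℝ) 1) :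
    0 < √(1 - m * a ^ 2) * √(1 - m * t ^ 2) - m * a * t * (√(1 - a ^ 2) * √(1 - t ^ 2)) := by
  obtain ⟨hca, hda⟩ := soloInformed_addm_radicands hm ha
  obtain ⟨hct, hdt⟩ := soloInformed_addm_radicands hm ht
  set P : ℝ := √(1 - m * a ^ 2) * √(1 - m * t ^ 2) with hP
  set Q : ℝ := m * a * t * (√(1 - a ^ 2) * √(1 - t ^ 2)) with hQ
  have hP0 : 0 < P := mul_pos (Real.sqrt_pos.2 hda) (Real.sqrt_pos.2 hdt)
  have hQ0 : 0 ≤ Q := mul_nonneg (mul_nonneg (mul_nonneg hm.1.le ha.1) ht.1)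
    (mul_nonneg (Real.sqrt_nonneg _) (Real.sqrt_nonneg _))
  have hP2 : P ^ 2 = (1 - m * a ^ 2) * (1 - m * t ^ 2) := by
    rw [hP, mul_pow, Real.sq_sqrt hda.le, Real.sq_sqrt hdt.le]
  have hQ2 : Q ^ 2 = m ^ 2 * a ^ 2 * t ^ 2 * ((1 - a ^ 2) * (1 - t ^ 2)) := by
    rw [hQ, mul_pow, mul_pow, mul_pow, mul_pow, Real.sq_sqrt hca, Real.sq_sqrt hct]
  -- `P² − Q² ≥ (1−m)² > 0`, with `u = 1−a²`, `v = 1−t²`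
  have hu : 0 ≤ 1 - a ^ 2 := hca
  have hv : 0 ≤ 1 - t ^ 2 := hct
  have hu1 : 1 - a ^ 2 ≤ 1 := by nlinarith [sq_nonneg a]
  have hkey : (1 - m) ^ 2 ≤ P ^ 2 - Q ^ 2 := by
    rw [hP2, hQ2]
    have e : (1 - m * a ^ 2) * (1 - m * t ^ 2) - m ^ 2 * a ^ 2 * t ^ 2 * ((1 - a ^ 2) * (1 - t ^ 2))
        - (1 - m) ^ 2 = m * (1 - m) * ((1 - a ^ 2) + (1 - t ^ 2)) +
          m ^ 2 * ((1 - a ^ 2) * (1 - t ^ 2)) * ((1 - a ^ 2) + (1 - t ^ 2) * (1 - (1 - a ^ 2))) := by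
      ring
    have h1 : 0 ≤ m * (1 - m) * ((1 - a ^ 2) + (1 - t ^ 2)) :=
      mul_nonneg (mul_nonneg hm.1.le (by linarith [hm.2])) (add_nonneg hu hv)
    have h2 : 0 ≤ m ^ 2 * ((1 - a ^ 2) * (1 - t ^ 2)) *
        ((1 - a ^ 2) + (1 - t ^ 2) * (1 - (1 - a ^ 2))) :=
      mul_nonneg (mul_nonneg (sq_nonneg m) (mul_nonneg hu hv))
        (add_nonneg hu (mul_nonneg hv (by linarith)))
    linarith
  have hm1 : 0 < (1 - m) ^ 2 := pow_pos (by linarith [hm.2]) 2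
  nlinarith [mul_nonneg hP0.le hQ0]

/-- The factorisation behind the sign lemma:
`(1−a²)(1−x) − a²x(1−m a²)(1−m x) = (1 − a² − x(1 − m a²))·(1 − m a² x)`. [this work] -/
theorem soloInformed_addm_sign_factor (m a x : ℝ) :
    (1 - a ^ 2) * (1 - x) - a ^ 2 * x * ((1 - m * a ^ 2) * (1 - m * x)) =
      (1 - a ^ 2 - x * (1 - m * a ^ 2)) * (1 - m * a ^ 2 * x) := by
  ring

/-- **Sign lemma.** For `a, t ∈ [0,1]`: `c_a c_t − a t d_a d_t > 0 ⟺ t²(1 − m a²) < 1 − a²`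
(the translated arc `u + v` stays inside the quarter period exactly on an algebraic slab).
[this work] -/
theorem soloInformed_addm_sign_iff {m a t : ℝ} (hm : m ∈ Ioo (0:ℝ) 1) (ha : a ∈ Icc (0:ℝ) 1)
    (ht : t ∈ Icc (0:ℝ) 1) :
    0 < √(1 - a ^ 2) * √(1 - t ^ 2) - a * t * (√(1 - m * a ^ 2) * √(1 - m * t ^ 2)) ↔
      t ^ 2 * (1 - m * a ^ 2) < 1 - a ^ 2 := by
  obtain ⟨hca, hda⟩ := soloInformed_addm_radicands hm ha
  obtain ⟨hct, hdt⟩ := soloInformed_addm_radicands hm ht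
  have hD1 : 0 < 1 - m * a ^ 2 * t ^ 2 := soloInformed_addm_denom_pos hm ha ht
  set P : ℝ := √(1 - a ^ 2) * √(1 - t ^ 2) with hP
  set Q : ℝ := a * t * (√(1 - m * a ^ 2) * √(1 - m * t ^ 2)) with hQ
  have hP0 : 0 ≤ P := mul_nonneg (Real.sqrt_nonneg _) (Real.sqrt_nonneg _)
  have hQ0 : 0 ≤ Q := mul_nonneg (mul_nonneg ha.1 ht.1)
    (mul_nonneg (Real.sqrt_nonneg _) (Real.sqrt_nonneg _))
  have hPQ : P ^ 2 - Q ^ 2 = (1 - a ^ 2 - t ^ 2 * (1 - m * a ^ 2)) * (1 - m * a ^ 2 * t ^ 2) := by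
    rw [hP, hQ, mul_pow, mul_pow, mul_pow, mul_pow, Real.sq_sqrt hca, Real.sq_sqrt hct,
      Real.sq_sqrt hda.le, Real.sq_sqrt hdt.le, ← soloInformed_addm_sign_factor]
  constructor
  · intro h
    have h2 : Q ^ 2 < P ^ 2 := by nlinarith
    have h3 : 0 < (1 - a ^ 2 - t ^ 2 * (1 - m * a ^ 2)) * (1 - m * a ^ 2 * t ^ 2) := by
      rw [← hPQ]; linarith
    have h4 : 0 < 1 - a ^ 2 - t ^ 2 * (1 - m * a ^ 2) := pos_of_mul_pos_left h3 hD1.le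
    linarith
  · intro h
    have h3 : 0 < P ^ 2 - Q ^ 2 := by
      rw [hPQ]; exact mul_pos (by linarith) hD1
    nlinarith

/-! ### Square roots of the addition theorems; range of `T_a` -/

/-- Under the sign condition: `√(1 − T_a(t)²) = (c_a c_t − a t d_a d_t)/(1 − m a²t²)`,
`√(1 − m T_a(t)²) = (d_a d_t − m a t c_a c_t)/(1 − m a²t²)`. [Jacobi 1829, §18] -/
theorem soloInformed_addm_sqrt {m a t : ℝ} (hm : m ∈ Ioo (0:ℝ) 1) (ha : a ∈ Icc (0:ℝ) 1)
    (ht : t ∈ Icc (0:ℝ) 1) (hs : t ^ 2 * (1 - m * a ^ 2) ≤ 1 - a ^ 2) :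
    √(1 - soloInformedAddm m a t ^ 2) =
        (√(1 - a ^ 2) * √(1 - t ^ 2) - a * t * (√(1 - m * a ^ 2) * √(1 - m * t ^ 2))) /
          (1 - m * a ^ 2 * t ^ 2) ∧
      √(1 - m * soloInformedAddm m a t ^ 2) =
        (√(1 - m * a ^ 2) * √(1 - m * t ^ 2) - m * a * t * (√(1 - a ^ 2) * √(1 - t ^ 2))) /
          (1 - m * a ^ 2 * t ^ 2) := by
  have hD := soloInformed_addm_denom_pos hm ha ht
  -- the `cn`-numerator is nonnegative under the (weak) sign condition
  have hg : 0 ≤ √(1 - a ^ 2) * √(1 - t ^ 2) - a * t * (√(1 - m * a ^ 2) * √(1 - m * t ^ 2)) := by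
    rcases hs.lt_or_eq with hs | hs
    · exact ((soloInformed_addm_sign_iff hm ha ht).2 hs).le
    · obtain ⟨hca, hda⟩ := soloInformed_addm_radicands hm ha
      obtain ⟨hct, hdt⟩ := soloInformed_addm_radicands hm ht
      set P : ℝ := √(1 - a ^ 2) * √(1 - t ^ 2) with hP
      set Q : ℝ := a * t * (√(1 - m * a ^ 2) * √(1 - m * t ^ 2)) with hQ
      have hP0 : 0 ≤ P := mul_nonneg (Real.sqrt_nonneg _) (Real.sqrt_nonneg _)
      have hQ0 : 0 ≤ Q := mul_nonneg (mul_nonneg ha.1 ht.1)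
        (mul_nonneg (Real.sqrt_nonneg _) (Real.sqrt_nonneg _))
      have hPQ : P ^ 2 = Q ^ 2 := by
        have e : P ^ 2 - Q ^ 2 =
            (1 - a ^ 2 - t ^ 2 * (1 - m * a ^ 2)) * (1 - m * a ^ 2 * t ^ 2) := by
          rw [hP, hQ, mul_pow, mul_pow, mul_pow, mul_pow, Real.sq_sqrt hca, Real.sq_sqrt hct,
            Real.sq_sqrt hda.le, Real.sq_sqrt hdt.le, ← soloInformed_addm_sign_factor]
        rw [hs, sub_self, zero_mul] at e
        linarith
      have : P = Q := (pow_left_inj₀ hP0 hQ0 two_ne_zero).1 hPQ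
      rw [this, sub_self]
  have hh := (soloInformed_addm_dn_pos hm ha ht).le
  constructor
  · have e : 1 - soloInformedAddm m a t ^ 2 =
        ((√(1 - a ^ 2) * √(1 - t ^ 2) - a * t * (√(1 - m * a ^ 2) * √(1 - m * t ^ 2))) /
          (1 - m * a ^ 2 * t ^ 2)) ^ 2 := by
      rw [div_pow, ← soloInformed_addm_one_sub_sq hm ha ht]
      field_simp
    rw [e, Real.sqrt_sq (div_nonneg hg hD.le)]
  · have e : 1 - m * soloInformedAddm m a t ^ 2 =
        ((√(1 - m * a ^ 2) * √(1 - m * t ^ 2) - m * a * t * (√(1 - a ^ 2) * √(1 - t ^ 2))) /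
          (1 - m * a ^ 2 * t ^ 2)) ^ 2 := by
      rw [div_pow, ← soloInformed_addm_one_sub_msq hm ha ht]
      field_simp
    rw [e, Real.sqrt_sq (div_nonneg hh hD.le)]

/-- `T_a(t) ≤ 1` for `a, t ∈ [0,1]`, and `T_a(t) < 1` under the strict sign condition. [folklore] -/
theorem soloInformed_addm_lt_one {m a t : ℝ} (hm : m ∈ Ioo (0:ℝ) 1) (ha : a ∈ Icc (0:ℝ) 1)
    (ht : t ∈ Icc (0:ℝ) 1) :
    soloInformedAddm m a t ≤ 1 ∧
      (t ^ 2 * (1 - m * a ^ 2) < 1 - a ^ 2 → soloInformedAddm m a t < 1) := by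
  have hD := soloInformed_addm_denom_pos hm ha ht
  have hT0 := soloInformed_addm_nonneg hm ha ht
  have hsq := soloInformed_addm_one_sub_sq hm ha ht
  have h1 : 0 ≤ 1 - soloInformedAddm m a t ^ 2 := by
    have : 0 ≤ (1 - m * a ^ 2 * t ^ 2) ^ 2 * (1 - soloInformedAddm m a t ^ 2) := by
      rw [hsq]; exact sq_nonneg _
    exact nonneg_of_mul_nonneg_right this (pow_pos hD 2)
  refine ⟨by nlinarith, fun hs => ?_⟩
  have hg := (soloInformed_addm_sign_iff hm ha ht).2 hs
  have h2 : 0 < 1 - soloInformedAddm m a t ^ 2 := by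
    have : 0 < (1 - m * a ^ 2 * t ^ 2) ^ 2 * (1 - soloInformedAddm m a t ^ 2) := by
      rw [hsq]; exact pow_pos hg 2
    exact pos_of_mul_pos_right this (pow_pos hD 2).le
  nlinarith

/-! ### The derivative of the addition map -/

/-- Abstract form of the derivative computation: the quotient-rule numerator times `c_t d_t`
equals `(c_a c_t − a t d_a d_t)(d_a d_t − m a t c_a c_t)`. [this work] -/
theorem soloInformed_addm_deriv_identity (m a t ca da ct dt : ℝ) (hA : ca ^ 2 = 1 - a ^ 2)
    (hB : da ^ 2 = 1 - m * a ^ 2) (hC : ct ^ 2 = 1 - t ^ 2) (hE : dt ^ 2 = 1 - m * t ^ 2) :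
    ((ca * da) * (ct * dt) + a * (-(t * dt ^ 2) - m * t * ct ^ 2)) * (1 - m * a ^ 2 * t ^ 2) +
        (t * (ca * da) + a * (ct * dt)) * (m * a ^ 2 * (2 * t)) * (ct * dt) =
      (ca * ct - a * t * (da * dt)) * (da * dt - m * a * t * (ca * ct)) := by
  linear_combination (a * t * m * ct ^ 2) * hA + (a * t * dt ^ 2) * hB +
    (m * a ^ 3 * t * dt ^ 2) * hC + (m * a ^ 3 * t * ct ^ 2) * hE

/-- **`T_a` is differentiable on `(0,1)` with derivative `soloInformedAddmDeriv`.** [this work] -/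
theorem soloInformed_addm_hasDerivAt {m a t : ℝ} (hm : m ∈ Ioo (0:ℝ) 1) (ha : a ∈ Icc (0:ℝ) 1)
    (ht : t ∈ Ioo (0:ℝ) 1) :
    HasDerivAt (soloInformedAddm m a) (soloInformedAddmDeriv m a t) t := by
  have ht' : t ∈ Icc (0:ℝ) 1 := ⟨ht.1.le, ht.2.le⟩
  obtain ⟨hca, hda⟩ := soloInformed_addm_radicands hm ha
  have hct : 0 < 1 - t ^ 2 := by nlinarith [ht.1, ht.2]
  have hdt : 0 < 1 - m * t ^ 2 := (soloInformed_addm_radicands hm ht').2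
  have hD := soloInformed_addm_denom_pos hm ha ht'
  have hCt : √(1 - t ^ 2) ≠ 0 := (Real.sqrt_pos.2 hct).ne'
  have hDt : √(1 - m * t ^ 2) ≠ 0 := (Real.sqrt_pos.2 hdt).ne'
  have hu : HasDerivAt (fun y : ℝ => √(1 - y ^ 2)) ((0 - 2 * t) / (2 * √(1 - t ^ 2))) t :=
    ((hasDerivAt_const t (1:ℝ)).sub (soloInformed_hasDerivAt_sq t)).sqrt hct.ne'
  have hv : HasDerivAt (fun y : ℝ => √(1 - m * y ^ 2)) ((0 - m * (2 * t)) / (2 * √(1 - m * t ^ 2))) t :=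
    ((hasDerivAt_const t (1:ℝ)).sub ((soloInformed_hasDerivAt_sq t).const_mul m)).sqrt hdt.ne'
  have hN : HasDerivAt (fun y : ℝ => y * (√(1 - a ^ 2) * √(1 - m * a ^ 2)) +
      a * (√(1 - y ^ 2) * √(1 - m * y ^ 2)))
      (1 * (√(1 - a ^ 2) * √(1 - m * a ^ 2)) + a * ((0 - 2 * t) / (2 * √(1 - t ^ 2)) *
        √(1 - m * t ^ 2) + √(1 - t ^ 2) * ((0 - m * (2 * t)) / (2 * √(1 - m * t ^ 2))))) t :=
    ((hasDerivAt_id' t).mul_const _).add ((hu.mul hv).const_mul a)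
  have hDen : HasDerivAt (fun y : ℝ => 1 - m * a ^ 2 * y ^ 2) (0 - m * a ^ 2 * (2 * t)) t :=
    (hasDerivAt_const t (1:ℝ)).sub ((soloInformed_hasDerivAt_sq t).const_mul (m * a ^ 2))
  have h := hN.div hDen hD.ne'
  refine h.congr_deriv ?_
  rw [soloInformedAddmDeriv]
  -- the algebra: clear the inner denominators, then the abstract identity
  set ca := √(1 - a ^ 2) with hca'
  set da := √(1 - m * a ^ 2) with hda'
  set ct := √(1 - t ^ 2) with hct'
  set dt := √(1 - m * t ^ 2) with hdt'
  have hWp : ((0 - 2 * t) / (2 * ct) * dt + ct * ((0 - m * (2 * t)) / (2 * dt))) * (ct * dt) =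
      -(t * dt ^ 2) - m * t * ct ^ 2 := by
    field_simp
    ring
  have key := soloInformed_addm_deriv_identity m a t ca da ct dt (Real.sq_sqrt hca)
    (Real.sq_sqrt hda.le) (Real.sq_sqrt hct.le) (Real.sq_sqrt hdt.le)
  have hcd : ct * dt ≠ 0 := mul_ne_zero hCt hDt
  rw [div_eq_div_iff (pow_ne_zero 2 hD.ne') (mul_ne_zero (pow_ne_zero 2 hD.ne') hcd)]
  calc ((1 * (ca * da) + a * ((0 - 2 * t) / (2 * ct) * dt + ct * ((0 - m * (2 * t)) / (2 * dt)))) *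
          (1 - m * a ^ 2 * t ^ 2) - (t * (ca * da) + a * (ct * dt)) * (0 - m * a ^ 2 * (2 * t))) *
        ((1 - m * a ^ 2 * t ^ 2) ^ 2 * (ct * dt))
      = (((ca * da) * (ct * dt) + a * (((0 - 2 * t) / (2 * ct) * dt +
          ct * ((0 - m * (2 * t)) / (2 * dt))) * (ct * dt))) * (1 - m * a ^ 2 * t ^ 2) +
          (t * (ca * da) + a * (ct * dt)) * (m * a ^ 2 * (2 * t)) * (ct * dt)) *
          (1 - m * a ^ 2 * t ^ 2) ^ 2 := by ring
    _ = (ca * ct - a * t * (da * dt)) * (da * dt - m * a * t * (ca * ct)) *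
          (1 - m * a ^ 2 * t ^ 2) ^ 2 := by rw [hWp, key]

/-- `T_a' > 0` under the strict sign condition. [this work] -/
theorem soloInformed_addmDeriv_pos {m a t : ℝ} (hm : m ∈ Ioo (0:ℝ) 1) (ha : a ∈ Icc (0:ℝ) 1)
    (ht : t ∈ Ioo (0:ℝ) 1) (hs : t ^ 2 * (1 - m * a ^ 2) < 1 - a ^ 2) :
    0 < soloInformedAddmDeriv m a t := by
  have ht' : t ∈ Icc (0:ℝ) 1 := ⟨ht.1.le, ht.2.le⟩
  have hct : 0 < 1 - t ^ 2 := by nlinarith [ht.1, ht.2]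
  have hdt : 0 < 1 - m * t ^ 2 := (soloInformed_addm_radicands hm ht').2
  exact div_pos (mul_pos ((soloInformed_addm_sign_iff hm ha ht').2 hs)
    (soloInformed_addm_dn_pos hm ha ht')) (mul_pos (pow_pos (soloInformed_addm_denom_pos hm ha ht') 2)
      (mul_pos (Real.sqrt_pos.2 hct) (Real.sqrt_pos.2 hdt)))

/-! ### The Jacobian identity (first kind) -/

/-- **Translation invariance of the differential of the first kind**: under the strict sign
condition, `κ(t) = κ(T_a(t))·|T_a'(t)|`, `κ(x) = (√(1−x²))⁻¹(√(1−m x²))⁻¹`. [Jacobi 1829, §18] -/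
theorem soloInformed_addm_jacobian {m a t : ℝ} (hm : m ∈ Ioo (0:ℝ) 1) (ha : a ∈ Icc (0:ℝ) 1)
    (ht : t ∈ Ioo (0:ℝ) 1) (hs : t ^ 2 * (1 - m * a ^ 2) < 1 - a ^ 2) :
    (√(1 - t ^ 2))⁻¹ * (√(1 - m * t ^ 2))⁻¹ =
      (√(1 - soloInformedAddm m a t ^ 2))⁻¹ * (√(1 - m * soloInformedAddm m a t ^ 2))⁻¹ *
        |soloInformedAddmDeriv m a t| := by
  have ht' : t ∈ Icc (0:ℝ) 1 := ⟨ht.1.le, ht.2.le⟩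
  have hct : 0 < 1 - t ^ 2 := by nlinarith [ht.1, ht.2]
  have hdt : 0 < 1 - m * t ^ 2 := (soloInformed_addm_radicands hm ht').2
  have hD := soloInformed_addm_denom_pos hm ha ht'
  obtain ⟨h1, h2⟩ := soloInformed_addm_sqrt hm ha ht' hs.le
  have hg := (soloInformed_addm_sign_iff hm ha ht').2 hs
  have hh := soloInformed_addm_dn_pos hm ha ht'
  rw [abs_of_pos (soloInformed_addmDeriv_pos hm ha ht hs), h1, h2, soloInformedAddmDeriv]
  set g := √(1 - a ^ 2) * √(1 - t ^ 2) - a * t * (√(1 - m * a ^ 2) * √(1 - m * t ^ 2)) with hg'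
  set h := √(1 - m * a ^ 2) * √(1 - m * t ^ 2) - m * a * t * (√(1 - a ^ 2) * √(1 - t ^ 2)) with hh'
  set D := 1 - m * a ^ 2 * t ^ 2 with hD'
  set ct := √(1 - t ^ 2) with hct'
  set dt := √(1 - m * t ^ 2) with hdt'
  have hg0 : g ≠ 0 := hg.ne'
  have hh0 : h ≠ 0 := hh.ne'
  have hD0 : D ≠ 0 := hD.ne'
  have hct0 : ct ≠ 0 := (Real.sqrt_pos.2 hct).ne'
  have hdt0 : dt ≠ 0 := (Real.sqrt_pos.2 hdt).ne'
  rw [inv_div, inv_div, div_mul_div_comm, div_mul_div_comm, eq_div_iff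
    (mul_ne_zero (mul_ne_zero hg0 hh0) (mul_ne_zero (pow_ne_zero 2 hD0) (mul_ne_zero hct0 hdt0)))]
  calc ct⁻¹ * dt⁻¹ * (g * h * (D ^ 2 * (ct * dt)))
      = (ct⁻¹ * ct) * (dt⁻¹ * dt) * (g * h * D ^ 2) := by ring
    _ = D * D * (g * h) := by rw [inv_mul_cancel₀ hct0, inv_mul_cancel₀ hdt0]; ring

end Summit.KontsevichZagierPeriods.KontsevichZagierPeriods.Theorems

end
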